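import Summits.CriticalPhenomena.PercolationContinuityZ3.Theorems.SahiMasterFamilySparseEndExpansion

/-!
# The sparse end of Sahi's hierarchy, VII: THE THEOREM — the leading coefficient of `E_k` at `p → 0` is nonnegative, every order

Support file of the master-family programme (crux `NoHeavyLowerTail`, stmt-CriticalPhenomena-4575; cell `prim-masterthm`, seat P4,
unit `prim-masterthm-p4-g4`).  Seat document PROOF-SPARSE-END.md.  Completes the chain
`SahiMasterFamilySparseEnd{Partitions, All, UnionClosed, Cores, Systems, Expansion}`.

With `SahiMasterFamilySparseEndExpansion.sahiE_spw_eq` (`E_{n+1}(spw w p; 1_U) = p^m Ẽ(p)`, an exact identity) this file evaluates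
`Ẽ(0)`: only the systems of representatives of cost exactly `m` survive, these are exactly the admissible systems of DISJOINT
representatives of the minimum configurations `c` of `⋂ U_i` (`sum_card_eq_card_biUnion` ⇒ pairwise disjoint), and on them the reduced
term is `w^c · ∏ (occ − 1)!`.  Hence

* `sparseE_zero_eq`:  `Ẽ(0) = Σ_{c ∈ ⋂U_i, |c| = m} w^c · Λ'(F^{(c)})`  (`Λ'` = `SahiSparseEnd.LambdaSys`, `F^{(c)}_i = {a ∈ U_i : a ⊆ c}`);
* **`sparseE_zero_nonneg`** (THE SPARSE-END THEOREM): for every `n`, every family of increasing events `U_0,…,U_n` (up-closed, `∅ ∉ U_i`,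
  `univ ∈ U_i`) and nonnegative intensities `w`, `Ẽ(0) ≥ 0` — i.e. `E_{n+1}(μ_{p·w}; U) = p^m (L + O(p))` with `L ≥ 0`.
HONEST FRAMING: first coefficient only; when `L = 0` (e.g. the OR-triangle) nothing is asserted.  Sahi `C_k` for product measures /
Kahn Conj. 5 remain open.  [this work]
-/

namespace Summit.CriticalPhenomena.PercolationContinuityZ3.Theorems

namespace SahiSparseEnd

open Finset SahiRepresentativeForm SahiLightAtoms
open Literature.Combinatorics.Sahi2008

variable {ι : Type*} [Fintype ι] [DecidableEq ι]

/-! ### Tight union bound forces disjointness -/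

omit [Fintype ι] in
/-- If `|⋃ A| = Σ_{a∈A} |a|` then the members of `A` are pairwise disjoint. [folklore] -/
theorem disjoint_of_card_biUnion_eq (A : Finset (Finset ι)) (h : (A.biUnion id).card = ∑ a ∈ A, a.card) :
    ∀ a ∈ A, ∀ b ∈ A, a ≠ b → Disjoint a b := by
  induction A using Finset.induction_on with
  | empty => intro a ha; exact absurd ha (by simp)
  | insert a A haA ih =>
    rw [biUnion_insert, sum_insert haA, id] at h
    have h1 : (a ∪ A.biUnion id).card ≤ a.card + (A.biUnion id).card := card_union_le _ _
    have h2 : (A.biUnion id).card ≤ ∑ b ∈ A, b.card := card_biUnion_le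
    have hdis : Disjoint a (A.biUnion id) := by
      rw [← card_union_eq_card_add_card]; omega
    have hA : (A.biUnion id).card = ∑ b ∈ A, b.card := by omega
    have ih' := ih hA
    intro x hx y hy hxy
    rcases mem_insert.1 hx with rfl | hx <;> rcases mem_insert.1 hy with hya | hy
    · exact absurd hya.symm hxy
    · exact hdis.mono_right (subset_biUnion_of_mem id hy)
    · rw [hya]; exact (hdis.mono_right (subset_biUnion_of_mem id hx)).symm
    · exact ih' x hx y hy hxy

/-! ### Evaluation at `p = 0` -/

section Events

variable {n : ℕ} (U : Fin (n + 1) → Finset (Finset ι))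
  (hU : ∀ i a a', a ∈ U i → a ⊆ a' → a' ∈ U i) (h0 : ∀ i, ∅ ∉ U i)

/-- The traces of the events on `2^c`. [this work] -/
def Fc (U : Fin (n + 1) → Finset (Finset ι)) (c : Finset ι) : Fin (n + 1) → Finset (Finset ι) := fun i => (U i).filter (· ⊆ c)

/-- The minimum configurations of `⋂ U_i`. [this work] -/
noncomputable def commonMin (U : Fin (n + 1) → Finset (Finset ι)) (h : (common U).Nonempty) : Finset (Finset ι) :=
  (common U).filter fun c => c.card = minSize U h

omit [DecidableEq ι] in
/-- `spw w 0 ω = 0` for `ω ≠ ∅`. [this work] -/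
theorem spw_zero [DecidableEq ι] (w : ι → ℝ) {ω : Finset ι} (hω : ω.Nonempty) : spw w 0 ω = 0 := by
  rw [spw_eq, zero_pow (card_pos.2 hω).ne', zero_mul]

/-- The reduced factor at `p = 0`: `w^a · j!` (`a ≠ ∅`). [this work] -/
theorem redFactor_zero (w : ι → ℝ) {a : Finset ι} (ha : a.Nonempty) (j : ℕ) :
    redFactor w 0 a j = (∏ e ∈ a, w e) * (j.factorial : ℝ) := by
  rw [redFactor, spw_zero w ha]
  simp only [zero_mul, sub_zero, prod_const_one, mul_one]
  rw [prod_range_add_one_real]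

include h0 in
/-- The reduced term at `p = 0`: `∏_{a ∈ im γ} w^a (occ_a − 1)!`. [this work] -/
theorem redTerm_zero (w : ι → ℝ) {γ : Fin (n + 1) → Finset ι} (hγ : γ ∈ Fintype.piFinset U) :
    redTerm w 0 γ = ∏ a ∈ univ.image γ, ((∏ e ∈ a, w e) * ((occ γ a - 1).factorial : ℝ)) := by
  refine prod_congr rfl fun a ha => redFactor_zero w ?_ _
  obtain ⟨i, -, rfl⟩ := mem_image.1 ha
  exact nonempty_iff_ne_empty.2 fun h => h0 i (h ▸ Fintype.mem_piFinset.1 hγ i)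

include hU h0 in
/-- `Ẽ(0)` as a sum over the systems of cost exactly `m`. [this work] -/
theorem sparseE_zero (w : ι → ℝ) (h : (common U).Nonempty) :
    sparseE w U (minSize U h) 0 = ∑ γ ∈ (Fintype.piFinset U).filter (fun γ => cost γ = minSize U h),
      (-1) ^ ((univ.image γ).card + 1) * ∏ a ∈ univ.image γ, ((∏ e ∈ a, w e) * ((occ γ a - 1).factorial : ℝ)) := by
  rw [sparseE, sum_filter]
  refine sum_congr rfl fun γ hγ => ?_
  have hle := minSize_le_cost U hU (h := h) hγ
  by_cases hc : cost γ = minSize U h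
  · rw [if_pos hc, hc, Nat.sub_self, pow_zero, one_mul, redTerm_zero U h0 w hγ]
  · rw [if_neg hc, zero_pow (by omega), zero_mul, mul_zero]

include hU in
/-- A system of cost `m` has union of size `m`, which is a minimum configuration. [this work] -/
theorem biUnion_mem_commonMin {h : (common U).Nonempty} {γ : Fin (n + 1) → Finset ι} (hγ : γ ∈ Fintype.piFinset U)
    (hc : cost γ = minSize U h) : univ.biUnion γ ∈ commonMin U h ∧ (univ.biUnion γ).card = cost γ := by
  have h1 : minSize U h ≤ (univ.biUnion γ).card := minSize_le U (biUnion_mem_common U hU hγ)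
  have h2 : (univ.biUnion γ).card ≤ cost γ := by
    rw [← biUnion_image_id]; exact card_biUnion_le
  refine ⟨mem_filter.2 ⟨biUnion_mem_common U hU hγ, by omega⟩, by omega⟩

include hU in
/-- **The systems of cost `m` with union `c` are exactly the admissible systems of `(F^{(c)}, c)`.** [this work] -/
theorem filter_cost_eq_systems {h : (common U).Nonempty} {c : Finset ι} (hc : c ∈ commonMin U h) :
    ((Fintype.piFinset U).filter fun γ => cost γ = minSize U h ∧ univ.biUnion γ = c) = systems (Fc U c) c := by
  rw [commonMin, mem_filter] at hc
  ext γ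
  rw [mem_filter, mem_systems, Fintype.mem_piFinset]
  constructor
  · rintro ⟨hγU, hcost, hunion⟩
    have hγ : γ ∈ Fintype.piFinset U := Fintype.mem_piFinset.2 hγU
    have hcard := (biUnion_mem_commonMin U hU hγ hcost).2
    rw [← biUnion_image_id, cost] at hcard
    have hdis := disjoint_of_card_biUnion_eq _ hcard
    refine ⟨fun i => mem_filter.2 ⟨hγU i, hunion ▸ subset_biUnion_of_mem γ (mem_univ i)⟩, fun i j => ?_, hunion⟩
    by_cases hij : γ i = γ j
    · exact Or.inl hij
    · exact Or.inr (hdis _ (mem_image_of_mem γ (mem_univ i)) _ (mem_image_of_mem γ (mem_univ j)) hij)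
  · rintro ⟨hF, hdis, hunion⟩
    have hγU : ∀ i, γ i ∈ U i := fun i => (mem_filter.1 (hF i)).1
    refine ⟨hγU, ?_, hunion⟩
    have hpd : ((univ.image γ : Finset (Finset ι)) : Set (Finset ι)).PairwiseDisjoint id := by
      intro a ha b hb hab
      obtain ⟨i, -, rfl⟩ := mem_image.1 (mem_coe.1 ha)
      obtain ⟨j, -, rfl⟩ := mem_image.1 (mem_coe.1 hb)
      exact (hdis i j).resolve_left hab
    have e := card_biUnion hpd
    simp only [id] at e
    rw [cost, ← e, biUnion_image_id, hunion, hc.2]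

include hU h0 in
/-- **`Ẽ(0) = Σ_{c ∈ ⋂U_i, |c| = m} w^c · Λ'(F^{(c)})`.** [this work] -/
theorem sparseE_zero_eq (w : ι → ℝ) (h : (common U).Nonempty) :
    sparseE w U (minSize U h) 0 = ∑ c ∈ commonMin U h, (∏ e ∈ c, w e) * (LambdaSys (Fc U c) c : ℝ) := by
  rw [sparseE_zero U hU h0 w h]
  rw [← sum_fiberwise_of_maps_to (t := commonMin U h) (g := fun γ => univ.biUnion γ) (fun γ hγ => by
    rw [mem_filter] at hγ; exact (biUnion_mem_commonMin U hU hγ.1 hγ.2).1)]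
  refine sum_congr rfl fun c hc => ?_
  rw [filter_filter, filter_cost_eq_systems U hU hc, LambdaSys, Int.cast_sum, mul_sum]
  refine sum_congr rfl fun γ hγ => ?_
  obtain ⟨-, hdis, hunion⟩ := mem_systems.1 hγ
  have hpd : ((univ.image γ : Finset (Finset ι)) : Set (Finset ι)).PairwiseDisjoint id := by
    intro a ha b hb hab
    obtain ⟨i, -, rfl⟩ := mem_image.1 (mem_coe.1 ha)
    obtain ⟨j, -, rfl⟩ := mem_image.1 (mem_coe.1 hb)
    exact (hdis i j).resolve_left hab
  have hw : ∏ a ∈ univ.image γ, ∏ e ∈ a, w e = ∏ e ∈ c, w e := by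
    have e := prod_biUnion hpd (f := w)
    simp only [id] at e
    rw [← e, biUnion_image_id, hunion]
  rw [prod_mul_distrib, hw]
  push_cast
  ring

include hU h0 in
/-- **THE SPARSE-END THEOREM.**  For every order `n + 1`, every family of increasing events `U_0,…,U_n` of a finite cube (up-closed,
`∅ ∉ U_i`, `univ ∈ U_i`) and all nonnegative intensities `w`, the leading coefficient `Ẽ(0)` of Sahi's functional
`E_{n+1}(μ_{p·w}; 1_{U_0},…,1_{U_n}) = p^m · Ẽ(p)` (`m` = the minimum size of a configuration in `⋂ U_i`; `sahiE_spw_eq`) is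
NONNEGATIVE. [this work] -/
theorem sparseE_zero_nonneg {w : ι → ℝ} (hw : ∀ e, 0 ≤ w e) (h : (common U).Nonempty) : 0 ≤ sparseE w U (minSize U h) 0 := by
  rw [sparseE_zero_eq U hU h0 w h]
  refine sum_nonneg fun c hc => mul_nonneg (prod_nonneg fun e _ => hw e) ?_
  have hc' := mem_filter.1 hc
  have hcU : ∀ i, c ∈ U i := (mem_common U).1 hc'.1
  refine Int.cast_nonneg (LambdaSys_nonneg (F := Fc U c) (c := c) ?_ ?_ ?_ (Nat.succ_pos n))
  · intro i a a' ha haa' ha'c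
    rw [Fc, mem_filter] at ha ⊢
    exact ⟨hU i a a' ha.1 haa', ha'c⟩
  · intro a hac
    constructor
    · intro hall
      have haU : a ∈ common U := (mem_common U).2 fun i => (mem_filter.1 (hall i)).1
      exact eq_of_subset_of_card_le hac (hc'.2 ▸ minSize_le U haU)
    · rintro rfl
      exact fun i => mem_filter.2 ⟨hcU i, subset_rfl⟩
  · intro i hi
    exact h0 i (mem_filter.1 hi).1

include hU h0 in
/-- The same in terms of `E` itself: `E_{n+1}(spw w p; 1_U) = p^m · Ẽ(p)` with `Ẽ(0) ≥ 0`. [this work] -/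
theorem sahiE_spw_sparse_end {w : ι → ℝ} (hw : ∀ e, 0 ≤ w e) (huniv : ∀ i, (univ : Finset ι) ∈ U i) :
    ∃ (m : ℕ) (Et : ℝ → ℝ), (∀ p, sahiE (spw w p) (n + 1) (fun i => setInd (U i)) = p ^ m * Et p) ∧ 0 ≤ Et 0 :=
  ⟨minSize U (common_nonempty U huniv), sparseE w U (minSize U (common_nonempty U huniv)),
    fun p => sahiE_spw_eq U hU w p _, sparseE_zero_nonneg U hU h0 hw _⟩

end Events

end SahiSparseEnd

end Summit.CriticalPhenomena.PercolationContinuityZ3.Theorems
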